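import Summits.RiemannHypothesis.RiemannHypothesis.Theorems.SemilocalNegCertWide
import HarnessLib

/-!
# Semi-local thresholds, negative side (IIId): piece bounds by MOMENTS — the kernel-cost lever for `WeilNegCertP`

Cell `rh-explicit` (HOME `run/shared/lean/pub/rh-explicit/`), seat cc-s2-4 gen9 (A4 lane, the Lean side).  Honest framing:
bookkeeping identities about the tree's rational certificate checkers; nothing here bears on RH.  No data is trusted.

MEASURED (gen9, `HOME/cc-s2-4/CC4-LEAN.md` §14): a kernel fact `c.checkPiece i = true` of a `WeilNegCertP` (`≈ 14 s` at degree 15)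
spends `≈ 5 s` recomputing the increment polynomial `incrementL c.p c.b` (the same in every fact of the instance), `≈ 5.6 s`
building the centred majorant `archMajorCL n m K u₀` (degree `≈ 100`, the same for every instance with the same cut `T₀`) and only
`≈ 3.5 s` on the product.  This file separates the three:

* `LQ.dotQ`, `LQ.momentQ M T₀ T₁ k = [∫ M(t) t^k dt]_{T₀}^{T₁}` (`momentQ_cast`), `LQ.moments M T₀ T₁ L` (the first `L` moments), and
  the IDENTITY `evQ (integ (mul M q)) T₁ − evQ (integ (mul M q)) T₀ = dotQ q (moments M T₀ T₁ L)` (`q.length ≤ L`;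
  `evQ_integ_mul_sub_eq_dotQ`), whence `pieceQ n m K q T₀ T₁ = dotQ q (moments (archMajorCL …) T₀ T₁ L)` (`pieceQ_eq_dotQ`) and the
  same for the wide majorant (`pieceWQ_eq_dotQ`);
* INTERVAL moments: `LQ.dotHiLo q lo hi` (`q_k · hi_k` for `q_k ≥ 0`, `q_k · lo_k` otherwise) with `dotQ q μ ≤ dotHiLo q lo hi` whenever
  `lo ≤ μ ≤ hi` entrywise (`dotQ_le_dotHiLo`), and the Boolean `LQ.momentsIn M T₀ T₁ lo hi` (the exact moments lie in the given
  rational intervals) — so a table of SHORT rational enclosures of the moments of the standard majorants on a standard grid of pieces,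
  verified ONCE (`SemilocalGridMomentsData*.lean`), replaces the majorant inside every instance;
* discharge lemmas for the EXISTING checkers (no new soundness theorem): `WeilNegCertP.checkPiece_of_momentsIn`,
  `checkPieceW_of_momentsIn` (grid pieces: from the increment literal, the table fact and a `decide` of `≈ 44` products),
  `checkPiece_of_inc` / `checkPieceW_of_inc` (the one irregular last piece `(T_g, 2b]`), `checkAtoms_of_inc` (the atom side from
  the increment literal, proved once per instance as `incrementL p b = inc` by `decide`).

Folklore throughout (exchange of a finite sum and an integral; sign-split interval dot product as in R. E. Moore, *Interval Analysis*
(1966) Ch. 3).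
-/

set_option autoImplicit false
set_option linter.dupNamespace false  -- the mandated namespace repeats `RiemannHypothesis`

noncomputable section

open MeasureTheory Set Finset

namespace Summit.RiemannHypothesis.RiemannHypothesis.Theorems.SemilocalPolyWitness

namespace LQ

/-! ## Dot products and moments -/

/-- Dot product of two coefficient lists, truncated at the shorter one. -/
def dotQ : List ℚ → List ℚ → ℚ
  | [], _ => 0
  | _ :: _, [] => 0
  | a :: as, m :: ms => a * m + dotQ as ms

/-- Sum form of the dot product when the second list is at least as long. -/
theorem dotQ_eq_sum : ∀ (q μ : List ℚ), q.length ≤ μ.length →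
    dotQ q μ = ∑ k ∈ Finset.range q.length, q.getD k 0 * μ.getD k 0
  | [], μ, _ => by simp [dotQ]
  | _ :: _, [], h => by simp at h
  | a :: as, m :: ms, h => by
      rw [dotQ, dotQ_eq_sum as ms (by simpa using h), List.length_cons, Finset.sum_range_succ']
      simp only [List.getD_cons_succ, List.getD_cons_zero]
      ring

/-- The `k`-th moment of the weight list `M` on `[T₀, T₁]`:
`[∫ M(t)·t^k dt]_{T₀}^{T₁} = T₁^{k+1}·(integAux M k)(T₁) − T₀^{k+1}·(integAux M k)(T₀)` (kernel-computable). -/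
def momentQ (M : List ℚ) (T0 T1 : ℚ) (k : ℕ) : ℚ :=
  T1 ^ (k + 1) * evQ (integAux M k) T1 - T0 ^ (k + 1) * evQ (integAux M k) T0

/-- `x^{k+1} · ev (integAux M k) x = Σ_j M_j x^{j+k+1}/(k+j+1)`. -/
theorem pow_mul_ev_integAux (M : List ℚ) (k : ℕ) (x : ℝ) :
    x ^ (k + 1) * ev (integAux M k) x =
      ∑ j ∈ Finset.range M.length, ((M.getD j 0 : ℚ) : ℝ) * x ^ (j + k + 1) / (k + j + 1) := by
  rw [ev_integAux, Finset.mul_sum]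
  refine Finset.sum_congr rfl fun j _ ↦ ?_
  rw [show j + k + 1 = (k + 1) + j by ring, pow_add]
  ring

/-- **The real meaning of `momentQ`**: `momentQ M T₀ T₁ k = ∫_{T₀}^{T₁} M(t)·t^k dt`. -/
theorem momentQ_cast (M : List ℚ) (T0 T1 : ℚ) (k : ℕ) :
    ((momentQ M T0 T1 k : ℚ) : ℝ) = ∫ t in (T0 : ℝ)..T1, ev M t * t ^ k := by
  have e : (fun t : ℝ ↦ ev M t * t ^ k) =
      fun t ↦ ∑ j ∈ Finset.range M.length, ((M.getD j 0 : ℚ) : ℝ) * t ^ (j + k) := by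
    funext t
    rw [ev_eq_sum, Finset.sum_mul]
    refine Finset.sum_congr rfl fun j _ ↦ ?_
    rw [pow_add]; ring
  rw [e, intervalIntegral.integral_finsetSum (f := fun j t ↦ ((M.getD j 0 : ℚ) : ℝ) * t ^ (j + k))
    (fun j _ ↦ ((continuous_const (y := ((M.getD j 0 : ℚ) : ℝ))).mul (continuous_pow (j + k))).intervalIntegrable _ _)]
  simp_rw [intervalIntegral.integral_const_mul, integral_pow]
  rw [momentQ]
  push_cast
  rw [← ev_ratCast, ← ev_ratCast, pow_mul_ev_integAux, pow_mul_ev_integAux, ← Finset.sum_sub_distrib]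
  refine Finset.sum_congr rfl fun j _ ↦ ?_
  ring

/-- The moments `k₀, k₀+1, …, k₀+L−1` of `M` on `[T₀, T₁]`. -/
def momentsFrom (M : List ℚ) (T0 T1 : ℚ) : ℕ → ℕ → List ℚ
  | _, 0 => []
  | k, L + 1 => momentQ M T0 T1 k :: momentsFrom M T0 T1 (k + 1) L

/-- The first `L` moments of `M` on `[T₀, T₁]` (`k = 0, …, L−1`). -/
def moments (M : List ℚ) (T0 T1 : ℚ) (L : ℕ) : List ℚ := momentsFrom M T0 T1 0 L

/-- `momentsFrom … k₀ L` has length `L`. -/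
theorem length_momentsFrom (M : List ℚ) (T0 T1 : ℚ) : ∀ (k0 L : ℕ), (momentsFrom M T0 T1 k0 L).length = L
  | _, 0 => rfl
  | k0, L + 1 => by rw [momentsFrom, List.length_cons, length_momentsFrom M T0 T1 (k0 + 1) L]

/-- `moments M T₀ T₁ L` has length `L`. -/
theorem length_moments (M : List ℚ) (T0 T1 : ℚ) (L : ℕ) : (moments M T0 T1 L).length = L :=
  length_momentsFrom M T0 T1 0 L

/-- The entries of `momentsFrom`. -/
theorem getD_momentsFrom (M : List ℚ) (T0 T1 : ℚ) :
    ∀ (k0 L j : ℕ), j < L → (momentsFrom M T0 T1 k0 L).getD j 0 = momentQ M T0 T1 (k0 + j)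
  | _, 0, _, h => absurd h (Nat.not_lt_zero _)
  | k0, L + 1, 0, _ => by rw [momentsFrom, List.getD_cons_zero, Nat.add_zero]
  | k0, L + 1, j + 1, h => by
      rw [momentsFrom, List.getD_cons_succ, getD_momentsFrom M T0 T1 (k0 + 1) L j (by omega),
        show k0 + 1 + j = k0 + (j + 1) by ring]

/-- The entries of `moments`: `(moments M T₀ T₁ L)[j] = momentQ M T₀ T₁ j` for `j < L`. -/
theorem getD_moments (M : List ℚ) (T0 T1 : ℚ) {L j : ℕ} (h : j < L) :
    (moments M T0 T1 L).getD j 0 = momentQ M T0 T1 j := by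
  rw [moments, getD_momentsFrom M T0 T1 0 L j h, Nat.zero_add]

/-- **The moment identity.**  For `q.length ≤ L`:
`[∫ M·q]_{T₀}^{T₁} = evQ (integ (mul M q)) T₁ − evQ (integ (mul M q)) T₀ = dotQ q (moments M T₀ T₁ L)`. -/
theorem evQ_integ_mul_sub_eq_dotQ (M q : List ℚ) (T0 T1 : ℚ) {L : ℕ} (hL : q.length ≤ L) :
    evQ (integ (mul M q)) T1 - evQ (integ (mul M q)) T0 = dotQ q (moments M T0 T1 L) := by
  have hR : (((evQ (integ (mul M q)) T1 - evQ (integ (mul M q)) T0 : ℚ)) : ℝ) =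
      ((dotQ q (moments M T0 T1 L) : ℚ) : ℝ) := by
    push_cast
    rw [← ev_ratCast, ← ev_ratCast, ← integral_ev, dotQ_eq_sum q _ (by rw [length_moments]; exact hL)]
    push_cast
    -- the integrand as a finite sum
    have e : (fun t : ℝ ↦ ev (mul M q) t) =
        fun t ↦ ∑ k ∈ Finset.range q.length, ((q.getD k 0 : ℚ) : ℝ) * (ev M t * t ^ k) := by
      funext t
      rw [ev_mul, ev_eq_sum q t, Finset.mul_sum]
      refine Finset.sum_congr rfl fun k _ ↦ ?_
      ring
    rw [e, intervalIntegral.integral_finsetSum (f := fun k t ↦ ((q.getD k 0 : ℚ) : ℝ) * (ev M t * t ^ k))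
      (fun k _ ↦ (((continuous_const (y := ((q.getD k 0 : ℚ) : ℝ))).mul
        ((continuous_ev M).mul (continuous_pow k))).intervalIntegrable _ _))]
    refine Finset.sum_congr rfl fun k hk ↦ ?_
    rw [intervalIntegral.integral_const_mul, ← momentQ_cast, getD_moments M T0 T1 (lt_of_lt_of_le (Finset.mem_range.1 hk) hL)]
  exact_mod_cast hR

/-- `pieceQ` by moments (centred majorant, windows `t ≤ 4`). -/
theorem pieceQ_eq_dotQ (n m K : ℕ) (q : List ℚ) (T0 T1 : ℚ) {L : ℕ} (hL : q.length ≤ L) :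
    pieceQ n m K q T0 T1 = dotQ q (moments (archMajorCL n m K (evQ (uSumL K) T0)) T0 T1 L) :=
  evQ_integ_mul_sub_eq_dotQ _ q T0 T1 hL

/-- `pieceWQ` by moments (wide majorant, windows `t ≤ 8`). -/
theorem pieceWQ_eq_dotQ (n m K : ℕ) (q : List ℚ) (T0 T1 : ℚ) {L : ℕ} (hL : q.length ≤ L) :
    pieceWQ n m K q T0 T1 = dotQ q (moments (archMajorWL n m K (evQ (uSumL K) T0)) T0 T1 L) :=
  evQ_integ_mul_sub_eq_dotQ _ q T0 T1 hL

/-! ## Interval moments -/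

/-- Sign-split dot product against interval bounds: `Σ_k (q_k ≥ 0 ? q_k·hi_k : q_k·lo_k)` (truncated at the shortest list). -/
def dotHiLo : List ℚ → List ℚ → List ℚ → ℚ
  | [], _, _ => 0
  | _ :: _, [], _ => 0
  | _ :: _, _ :: _, [] => 0
  | a :: as, l :: ls, h :: hs => (if 0 ≤ a then a * h else a * l) + dotHiLo as ls hs

/-- Boolean: `lo_k ≤ μ_k ≤ hi_k` for the first `μ.length` entries (and `lo`, `hi` are at least as long as `μ`). -/
def betweenL : List ℚ → List ℚ → List ℚ → Bool
  | [], _, _ => true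
  | _ :: _, [], _ => false
  | _ :: _, _ :: _, [] => false
  | m :: ms, l :: ls, h :: hs => decide (l ≤ m) && decide (m ≤ h) && betweenL ms ls hs

/-- **Sign-split bound.**  If `lo ≤ μ ≤ hi` entrywise (`betweenL μ lo hi`) and `q` is no longer than `μ`, then
`dotQ q μ ≤ dotHiLo q lo hi`. -/
theorem dotQ_le_dotHiLo : ∀ (q μ lo hi : List ℚ), q.length ≤ μ.length → betweenL μ lo hi = true →
    dotQ q μ ≤ dotHiLo q lo hi
  | [], _, _, _, _, _ => by simp [dotQ, dotHiLo]
  | _ :: _, [], _, _, h, _ => by simp at h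
  | _ :: _, _ :: _, [], _, _, h => by simp [betweenL] at h
  | _ :: _, _ :: _, _ :: _, [], _, h => by simp [betweenL] at h
  | a :: as, m :: ms, l :: ls, h :: hs, hlen, hb => by
      simp only [betweenL, Bool.and_eq_true, decide_eq_true_eq] at hb
      obtain ⟨⟨hlm, hmh⟩, hrest⟩ := hb
      have ih := dotQ_le_dotHiLo as ms ls hs (by simpa using hlen) hrest
      simp only [dotQ, dotHiLo]
      split_ifs with ha
      · nlinarith
      · have ha' : a < 0 := lt_of_not_ge ha
        nlinarith

/-- Boolean: the exact moments `0, …, L−1` of `M` on `[T₀, T₁]` lie in the given rational intervals (`L = lo.length`). -/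
def momentsIn (M : List ℚ) (T0 T1 : ℚ) (lo hi : List ℚ) : Bool :=
  betweenL (moments M T0 T1 lo.length) lo hi

/-- **Piece value by interval moments**: `[∫ M·q]_{T₀}^{T₁} ≤ dotHiLo q lo hi` when `momentsIn M T₀ T₁ lo hi` and
`q.length ≤ lo.length`. -/
theorem evQ_integ_mul_sub_le_dotHiLo (M q : List ℚ) (T0 T1 : ℚ) {lo hi : List ℚ}
    (hin : momentsIn M T0 T1 lo hi = true) (hL : q.length ≤ lo.length) :
    evQ (integ (mul M q)) T1 - evQ (integ (mul M q)) T0 ≤ dotHiLo q lo hi := by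
  rw [evQ_integ_mul_sub_eq_dotQ M q T0 T1 hL]
  exact dotQ_le_dotHiLo q _ lo hi (by rw [length_moments]; exact hL) hin

end LQ

/-! ## Discharging the kernel facts of `WeilNegCertP` from the increment literal and the moment tables -/

namespace WeilNegCertP

open LQ

variable (c : WeilNegCertP)

/-- Grid piece `i` of a `WeilNegCertP` (centred majorant, `b ≤ 2`) from: the increment literal (`hinc`), the cut and claim
literals, a moment-table fact `momentsIn (archMajorCL …) T₀ T₁ lo hi = true`, and the cheap `decide` of `dotHiLo inc.tail lo hi ≤ B`. -/
theorem checkPiece_of_momentsIn {i : ℕ} {inc lo hi : List ℚ} {T0 T1 B : ℚ}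
    (hinc : incrementL c.p c.b = inc) (hT0 : (0 :: c.cuts).getD i 0 = T0) (hT1 : c.cuts.getD i 0 = T1)
    (hB : c.pieceB.getD i 0 = B)
    (hin : momentsIn (archMajorCL c.nA c.mA c.KA (evQ (uSumL c.KA) T0)) T0 T1 lo hi = true)
    (hL : inc.tail.length ≤ lo.length) (hdot : dotHiLo inc.tail lo hi ≤ B) : c.checkPiece i = true := by
  rw [checkPiece, decide_eq_true_eq, hT0, hT1, hB, WeilNegCertP.q, hinc, pieceQ]
  exact (evQ_integ_mul_sub_le_dotHiLo _ _ T0 T1 hin hL).trans hdot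

/-- Grid piece `i`, WIDE majorant (`b ≤ 4`): as `checkPiece_of_momentsIn` with `archMajorWL`. -/
theorem checkPieceW_of_momentsIn {i : ℕ} {inc lo hi : List ℚ} {T0 T1 B : ℚ}
    (hinc : incrementL c.p c.b = inc) (hT0 : (0 :: c.cuts).getD i 0 = T0) (hT1 : c.cuts.getD i 0 = T1)
    (hB : c.pieceB.getD i 0 = B)
    (hin : momentsIn (archMajorWL c.nA c.mA c.KA (evQ (uSumL c.KA) T0)) T0 T1 lo hi = true)
    (hL : inc.tail.length ≤ lo.length) (hdot : dotHiLo inc.tail lo hi ≤ B) : c.checkPieceW i = true := by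
  rw [checkPieceW, decide_eq_true_eq, hT0, hT1, hB, WeilNegCertP.q, hinc, pieceWQ]
  exact (evQ_integ_mul_sub_le_dotHiLo _ _ T0 T1 hin hL).trans hdot

/-- Any piece `i` (in particular the irregular last piece `(T_g, 2b]`) from the increment literal and a direct `decide` of
`pieceQ … inc.tail T₀ T₁ ≤ B`. -/
theorem checkPiece_of_inc {i : ℕ} {inc : List ℚ} {T0 T1 B : ℚ}
    (hinc : incrementL c.p c.b = inc) (hT0 : (0 :: c.cuts).getD i 0 = T0) (hT1 : c.cuts.getD i 0 = T1)
    (hB : c.pieceB.getD i 0 = B) (h : pieceQ c.nA c.mA c.KA inc.tail T0 T1 ≤ B) : c.checkPiece i = true := by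
  rw [checkPiece, decide_eq_true_eq, hT0, hT1, hB, WeilNegCertP.q, hinc]
  exact h

/-- Any piece `i`, WIDE majorant, from the increment literal and a direct `decide` of `pieceWQ … ≤ B`. -/
theorem checkPieceW_of_inc {i : ℕ} {inc : List ℚ} {T0 T1 B : ℚ}
    (hinc : incrementL c.p c.b = inc) (hT0 : (0 :: c.cuts).getD i 0 = T0) (hT1 : c.cuts.getD i 0 = T1)
    (hB : c.pieceB.getD i 0 = B) (h : pieceWQ c.nA c.mA c.KA inc.tail T0 T1 ≤ B) : c.checkPieceW i = true := by
  rw [checkPieceW, decide_eq_true_eq, hT0, hT1, hB, WeilNegCertP.q, hinc]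
  exact h

/-- The atom side from the increment literal: `atomLhsQ inc c.atoms ≤ c.atomB → c.checkAtoms`. -/
theorem checkAtoms_of_inc {inc : List ℚ} (hinc : incrementL c.p c.b = inc) (h : atomLhsQ inc c.atoms ≤ c.atomB) :
    c.checkAtoms = true := by
  rw [checkAtoms, decide_eq_true_eq, hinc]
  exact h

end WeilNegCertP

/-! ## Appendix (cc-s2-4 gen10, 2026-08-24): the users of this module and the grid convention beyond `18/4`

Documentation only — no declaration is added or changed (this re-commit also lets the hub build drain pick the module up:
it was accepted 2026-08-23T14:23Z but never built, OPS-REQUESTS 2026-08-24T01:09Z).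

* TABLES.  `SemilocalGridMomentsDataP.lean` holds `gridP_momentsIn_i` for the pieces `(i/4, (i+1)/4]`, `i < 16`, of the
  CENTRED majorant `archMajorCL 10 4 5`; `SemilocalGridMomentsDataW.lean` (`i < 9`) and `…DataWFar.lean` (`9 ≤ i < 18`) the
  same for the WIDE majorant `archMajorWL 10 4 8` (sinh-minorant order `8`: order `5` loses ≈ 1e-4·N of slack at `t > 4`,
  which decides the rows `q = 71, 73` — CC4-LEAN §14.7).  Each table fact is one `decide +kernel` of 44 interval moments.
* ROWS.  A wall row `SemilocalNegCert<Name>.lean` proves its increment literal once (`inc_<Id> : incrementL p b = <literal>`),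
  cuts the bulk `(0, 2b]` at `k/4` for `k ≤ g := min ⌊8b⌋ 18` (`16` for the centred format) and discharges every grid piece
  `i < g` by `checkPiece[W]_of_momentsIn inc_<Id> rfl rfl rfl grid{P,W}_momentsIn_i (by decide) (by decide +kernel)`; the
  one off-grid remainder `(g/4, 2b]` — of length `< 1/4` for `2b ≤ 19/4`, longer for the far walls `q ≥ 113` whose windows
  end beyond the last table piece — goes through `checkPiece[W]_of_inc` with a direct `decide +kernel` of the majorant value;
  the atom side uses `checkAtoms_of_inc` (or the FAST evaluator of `SemilocalNegCertAtomsFast.lean` for degree ≥ 17).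
* USERS (kernel-verified rows of the LIGHT layout, cc-s2-4 gen9/gen10): `SemilocalNegCert{Thirteen, Seven121,
  TwoThreeFive09825, Seventeen, Nineteen, TwentyThree, TwentyNine, UptoThirtyOne, UptoThirtySeven, UptoFortyOne,
  UptoFortyThree}` (table P) and `SemilocalNegCert{UptoFortySeven, UptoFiftyThree, UptoFiftyNine, UptoSixtyOne,
  UptoSixtySeven, UptoSeventyOne, UptoSeventyThree, UptoSeventyNine, UptoEightyThree, UptoEightyNine, UptoHundredOne,
  UptoHundredSeven, UptoHundredNine, UptoHundredThirteen, UptoHundredTwentySeven}` (tables W/WFar) — the walls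
  `q = 17 … 131` except the twin-prime walls `q = 101, 107`, which the degree-≤ 21 polynomial class cannot reach
  (its certifiable knee sits ≈ 0.013 above `(log q)/2`, the twin gap `½·log(q⁺/q)` is `< 0.01`; CC4-LEAN §15.4).
-/

/-! ### Addendum (cc-s2-4 gen11, 2026-08-24)

Documentation only; every declaration byte-identical.  Second re-commit: the 2026-08-24T02:52Z one landed while the hub build
worker was not draining `Summits/RiemannHypothesis/RiemannHypothesis/Theorems` (OPS-REQUESTS l.221), so the module — and with it the
gate-parked table `SemilocalGridMomentsDataP` (p368904) and the whole LIGHT row chain — still had no olean at 07:50Z; commits after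
07:05Z are built within minutes (e.g. `SemilocalDeletionDipole`, 07:22Z → 07:25Z).
-/

/-! #### Build note

Third re-commit (cc-s2-4 gen11, 2026-08-24T08:3xZ): the 07:55Z one was accepted (p376641) but drew no build within 35 min while RH accepts of 07:18–07:50Z and 08:02–08:07Z built in 2–8 min (per-module dispatch; OPS-REQUESTS l.221 / ops-buildfix T07 line); documentation only, declarations byte-identical.
-/

end Summit.RiemannHypothesis.RiemannHypothesis.Theorems.SemilocalPolyWitness

end
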